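import Mathlib
import Literature.MathematicalPhysics.StatisticalMechanics.LennardJonesClusters
import HarnessLib

/-!
# Two-scale shell sums over separated point sets of `ℝ³`

Companion of `LennardJonesClusters.sum_inv_pow_six_le` (one scale: separation = distance) and of
`SeparatedShellSums.lean`: if the points of a finite set `t ⊆ ℝ³` are pairwise `≥ η` apart and all
at distance `≥ ρ ≥ η > 0` from a point `p` (which need not belong to `t`, nor be `η`-far from it in
any other sense), then

* `sum_inv_pow_six_le_two_scale` : `∑_{z ∈ t} |p - z|⁻⁶ ≤ 250 η⁻³ ρ⁻³` — the shell
  `⌊|p - z| / ρ⌋ = b ≥ 1` holds at most `((2b + 3) ρ / η)³ ≤ 125 b³ (ρ/η)³` points (volume packing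
  `card_le_of_separated_of_dist_le`), each contributing `≤ (b ρ)⁻⁶`, and `∑_{b ≥ 1} b⁻² ≤ 2`;
* `abs_lennardJones_le_inv_pow_six` : `|V_LJ(r)| ≤ (η⁻⁶/12 + 1/6) r⁻⁶` for `r ≥ η > 0`;
* `sum_abs_lennardJones_le_two_scale` : hence `∑_{z ∈ t} |V_LJ(|p - z|)| ≤ (η⁻⁶/12 + 1/6) · 250 η⁻³ ρ⁻³`.

This is the generic tail estimate behind every "far partners of one site" bound of the restacking
competitor of `stmt-AtomisticToContinuum-14296` (crux `StackingFaultSparsity`); the two-scale form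
(adapted from the route file `PalmUnimodularRigidityMinimiserShellsMuGSCBasics`, whose imports are
not generally compatible) is recorded here for reuse. Elementary ([folklore]).
-/

noncomputable section

namespace Literature.MathematicalPhysics.StatisticalMechanics

/-- **Shell sum with two scales.** If the points of a finite set `t ⊆ ℝ³` are pairwise `≥ η` apart
and all at distance `≥ ρ ≥ η > 0` from `p`, then `∑_{z ∈ t} |p - z|⁻⁶ ≤ 250 η⁻³ ρ⁻³`. [folklore] -/
theorem sum_inv_pow_six_le_two_scale (t : Finset (EuclideanSpace ℝ (Fin 3)))
    (p : EuclideanSpace ℝ (Fin 3)) {η ρ : ℝ} (hη : 0 < η) (hηρ : η ≤ ρ)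
    (ht : ∀ z ∈ t, ∀ w ∈ t, z ≠ w → η ≤ dist z w) (hp : ∀ z ∈ t, ρ ≤ dist p z) :
    ∑ z ∈ t, (dist p z)⁻¹ ^ 6 ≤ 250 * η⁻¹ ^ 3 * ρ⁻¹ ^ 3 := by
  -- adapted from `PalmUnimodularRigidityMinimiserShellsMuGSCBasics.sum_inv_pow_six_le_of_sep`
  classical
  have hρ : 0 < ρ := hη.trans_le hηρ
  set m : EuclideanSpace ℝ (Fin 3) → ℕ := fun z => ⌊dist p z / ρ⌋₊ with hm
  set u := t.image m with hu_def
  have hmem : ∀ z ∈ t, m z ∈ u := fun z hz => Finset.mem_image_of_mem m hz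
  have hm1 : ∀ z ∈ t, 1 ≤ m z := fun z hz =>
    (Nat.one_le_floor_iff _).2 ((one_le_div hρ).2 (hp z hz))
  have hmle : ∀ z ∈ t, ρ * m z ≤ dist p z := fun z hz => by
    have := Nat.floor_le (div_nonneg dist_nonneg hρ.le : 0 ≤ dist p z / ρ)
    rwa [le_div_iff₀ hρ, mul_comm] at this
  have hmlt : ∀ z ∈ t, dist p z < (m z + 1) * ρ := fun z hz => by
    have := Nat.lt_floor_add_one (dist p z / ρ)
    rwa [div_lt_iff₀ hρ] at this
  -- termwise: `|p - z|⁻⁶ ≤ (ρ m_z)⁻⁶`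
  have step1 : ∑ z ∈ t, (dist p z)⁻¹ ^ 6 ≤ ∑ z ∈ t, ρ⁻¹ ^ 6 * ((m z : ℝ))⁻¹ ^ 6 := by
    refine Finset.sum_le_sum fun z hz => ?_
    rw [← mul_pow, ← mul_inv]
    have h0 : 0 < ρ * m z := mul_pos hρ (by exact_mod_cast hm1 z hz)
    exact pow_le_pow_left₀ (inv_nonneg.2 dist_nonneg) (inv_anti₀ h0 (hmle z hz)) _
  -- regroup by shells
  have step2 : ∑ z ∈ t, ρ⁻¹ ^ 6 * ((m z : ℝ))⁻¹ ^ 6 =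
      ∑ b ∈ u, ((t.filter fun z => m z = b).card : ℝ) * (ρ⁻¹ ^ 6 * ((b : ℝ))⁻¹ ^ 6) := by
    have := Finset.sum_fiberwise_of_maps_to' hmem (fun b : ℕ => ρ⁻¹ ^ 6 * ((b : ℝ))⁻¹ ^ 6)
    simp only [Finset.sum_const, nsmul_eq_mul] at this
    exact this.symm
  -- each shell holds at most `((2b+3) ρ/η)³` points
  have step3 : ∀ b ∈ u, ((t.filter fun z => m z = b).card : ℝ) ≤
      ((2 * (b : ℝ) + 3) * (ρ / η)) ^ 3 := by
    intro b _
    set F := t.filter fun z => m z = b with hF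
    have hR : (0 : ℝ) ≤ ((b : ℝ) + 1) * ρ := by positivity
    have hcard := card_le_of_separated_of_dist_le F p hη hR ?_ ?_
    · rw [finrank_euclideanSpace_fin] at hcard
      refine hcard.trans (pow_le_pow_left₀ (by positivity) ?_ 3)
      have h1 : (1 : ℝ) ≤ ρ / η := (one_le_div hη).2 hηρ
      calc 2 * (((b : ℝ) + 1) * ρ) / η + 1 ≤ 2 * (((b : ℝ) + 1) * ρ) / η + ρ / η := by linarith
        _ = (2 * (b : ℝ) + 3) * (ρ / η) := by ring
    · intro c hc
      obtain ⟨hct, hcb⟩ := Finset.mem_filter.1 hc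
      rw [dist_comm]
      have := hmlt c hct
      rw [hcb] at this
      exact this.le
    · intro c hc c' hc' hne
      exact ht c (Finset.mem_filter.1 hc).1 c' (Finset.mem_filter.1 hc').1 hne
  -- numerics per shell: `((2b+3) ρ/η)³ ρ⁻⁶ b⁻⁶ ≤ 125 η⁻³ ρ⁻³ b⁻²` for `b ≥ 1`
  have step4 : ∀ b ∈ u, ((2 * (b : ℝ) + 3) * (ρ / η)) ^ 3 * (ρ⁻¹ ^ 6 * ((b : ℝ))⁻¹ ^ 6) ≤
      125 * (η⁻¹ ^ 3 * ρ⁻¹ ^ 3) * ((b : ℝ) ^ 2)⁻¹ := by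
    intro b hb
    obtain ⟨z, hz, rfl⟩ := Finset.mem_image.1 hb
    have hb1 : (1 : ℝ) ≤ (m z : ℝ) := by exact_mod_cast hm1 z hz
    set β : ℝ := (m z : ℝ)
    have hβ : 0 < β := by linarith
    have key : (2 * β + 3) ^ 3 * (β⁻¹) ^ 6 ≤ 125 * (β ^ 2)⁻¹ := by
      rw [inv_pow, ← div_eq_mul_inv, ← div_eq_mul_inv,
        div_le_div_iff₀ (by positivity) (by positivity)]
      have h5 : (2 * β + 3) ^ 3 ≤ (5 * β) ^ 3 :=
        pow_le_pow_left₀ (by positivity) (by linarith) 3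
      have h6 : β ^ 5 ≤ β ^ 6 := pow_le_pow_right₀ hb1 (by norm_num)
      nlinarith [mul_le_mul_of_nonneg_right h5 (sq_nonneg β)]
    have hρη : (ρ / η) ^ 3 * ρ⁻¹ ^ 6 = η⁻¹ ^ 3 * ρ⁻¹ ^ 3 := by
      have hρ0 : ρ ≠ 0 := hρ.ne'
      have hη0 : η ≠ 0 := hη.ne'
      field_simp
    calc ((2 * β + 3) * (ρ / η)) ^ 3 * (ρ⁻¹ ^ 6 * (β⁻¹) ^ 6)
        = ((ρ / η) ^ 3 * ρ⁻¹ ^ 6) * ((2 * β + 3) ^ 3 * (β⁻¹) ^ 6) := by ring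
      _ ≤ (η⁻¹ ^ 3 * ρ⁻¹ ^ 3) * (125 * (β ^ 2)⁻¹) := by
          rw [hρη]; exact mul_le_mul_of_nonneg_left key (by positivity)
      _ = 125 * (η⁻¹ ^ 3 * ρ⁻¹ ^ 3) * (β ^ 2)⁻¹ := by ring
  -- `∑_{b ∈ u} b⁻² ≤ 2`
  have step5 : ∑ b ∈ u, ((b : ℝ) ^ 2)⁻¹ ≤ 2 := by
    have hsub : u ⊆ Finset.Ioo 0 (u.sup id + 1) := fun b hb => by
      rw [Finset.mem_Ioo]
      obtain ⟨z, hz, rfl⟩ := Finset.mem_image.1 hb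
      exact ⟨hm1 z hz, Nat.lt_succ_of_le (Finset.le_sup (f := id) hb)⟩
    have h2 := sum_Ioo_inv_sq_le (α := ℝ) 0 (u.sup id + 1)
    calc ∑ b ∈ u, ((b : ℝ) ^ 2)⁻¹ ≤ ∑ b ∈ Finset.Ioo 0 (u.sup id + 1), ((b : ℝ) ^ 2)⁻¹ :=
          Finset.sum_le_sum_of_subset_of_nonneg hsub fun b _ _ => by positivity
      _ ≤ 2 := by simpa using h2
  calc ∑ z ∈ t, (dist p z)⁻¹ ^ 6
      ≤ ∑ b ∈ u, ((t.filter fun z => m z = b).card : ℝ) * (ρ⁻¹ ^ 6 * ((b : ℝ))⁻¹ ^ 6) :=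
        step1.trans_eq step2
    _ ≤ ∑ b ∈ u, ((2 * (b : ℝ) + 3) * (ρ / η)) ^ 3 * (ρ⁻¹ ^ 6 * ((b : ℝ))⁻¹ ^ 6) :=
        Finset.sum_le_sum fun b hb => mul_le_mul_of_nonneg_right (step3 b hb) (by positivity)
    _ ≤ ∑ b ∈ u, 125 * (η⁻¹ ^ 3 * ρ⁻¹ ^ 3) * ((b : ℝ) ^ 2)⁻¹ := Finset.sum_le_sum step4
    _ = 125 * (η⁻¹ ^ 3 * ρ⁻¹ ^ 3) * ∑ b ∈ u, ((b : ℝ) ^ 2)⁻¹ := by rw [Finset.mul_sum]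
    _ ≤ 125 * (η⁻¹ ^ 3 * ρ⁻¹ ^ 3) * 2 := mul_le_mul_of_nonneg_left step5 (by positivity)
    _ = 250 * η⁻¹ ^ 3 * ρ⁻¹ ^ 3 := by ring

/-- `|V_LJ(r)| ≤ (η⁻⁶/12 + 1/6) r⁻⁶` for `r ≥ η > 0` (`r⁻¹² = r⁻⁶ · r⁻⁶ ≤ η⁻⁶ r⁻⁶`). [folklore] -/
theorem abs_lennardJones_le_inv_pow_six {η r : ℝ} (hη : 0 < η) (hr : η ≤ r) :
    |lennardJones r| ≤ (η⁻¹ ^ 6 / 12 + 1 / 6) * r⁻¹ ^ 6 := by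
  have hr0 : 0 < r := hη.trans_le hr
  set u : ℝ := r⁻¹ ^ 6 with hu
  have hu0 : 0 ≤ u := by positivity
  have huη : u ≤ η⁻¹ ^ 6 := pow_le_pow_left₀ (inv_nonneg.2 hr0.le) (inv_anti₀ hη hr) 6
  have h12 : r⁻¹ ^ 12 = u * u := by rw [hu]; ring
  have huu : u * u ≤ η⁻¹ ^ 6 * u := mul_le_mul_of_nonneg_right huη hu0
  unfold lennardJones
  rw [h12, abs_le]
  constructor <;> nlinarith

/-- **Lennard-Jones far partners of one site.** If the points of `t ⊆ ℝ³` are pairwise `≥ η` apart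
and all at distance `≥ ρ ≥ η > 0` from `p`, then
`∑_{z ∈ t} |V_LJ(|p - z|)| ≤ (η⁻⁶/12 + 1/6) · 250 η⁻³ ρ⁻³`. [folklore] -/
theorem sum_abs_lennardJones_le_two_scale (t : Finset (EuclideanSpace ℝ (Fin 3)))
    (p : EuclideanSpace ℝ (Fin 3)) {η ρ : ℝ} (hη : 0 < η) (hηρ : η ≤ ρ)
    (ht : ∀ z ∈ t, ∀ w ∈ t, z ≠ w → η ≤ dist z w) (hp : ∀ z ∈ t, ρ ≤ dist p z) :
    ∑ z ∈ t, |lennardJones (dist p z)| ≤ (η⁻¹ ^ 6 / 12 + 1 / 6) * (250 * η⁻¹ ^ 3 * ρ⁻¹ ^ 3) := by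
  have h1 : ∑ z ∈ t, |lennardJones (dist p z)| ≤ ∑ z ∈ t, (η⁻¹ ^ 6 / 12 + 1 / 6) * (dist p z)⁻¹ ^ 6 :=
    Finset.sum_le_sum fun z hz => abs_lennardJones_le_inv_pow_six hη (hηρ.trans (hp z hz))
  rw [← Finset.mul_sum] at h1
  exact h1.trans (mul_le_mul_of_nonneg_left (sum_inv_pow_six_le_two_scale t p hη hηρ ht hp)
    (by positivity))

end Literature.MathematicalPhysics.StatisticalMechanics

end
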